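import Summits.CriticalPhenomena.PercolationContinuityZ3.Theorems.PercNearOneGluingAdditiveGluingCAG
import HarnessLib

/-!
# Crux `PercNearOneGluing.AdditiveGluing` (stmt-CriticalPhenomena-4576): the crux for EVERY |A| from ONE set-gluing kernel (K₀-set)

Support file (`--supports stmt-CriticalPhenomena-4576`; lead-of-record prim-png-lead-4576, gen 2).  No definitions, no named facts,
no sorries.  The one external input — the half Theorem 1 of the glued weighting, pulled back — enters as the hypothesis `hHalf`
(discharged from `twoStep_thm1_half` + `…SetGluePullback.lean`, p183711, in the sibling file `…SetGlueK0Closed.lean`).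

Setting: weighted complete graph on `Fin n`, `μ = prodBernoulli w`, target `b`, observer `o`, a relay set written as `{c} ⊔ S`
(`c ∉ S` the SPECTATOR, `S` the set to be GLUED, `s₀ ∈ S` a minimiser of `τ = μ(· ↔ b)` on `S`).  Events:
`CS = ⋃_{s∈S} {c ↔ s}` (so `CSᶜ = {c ↮ S}`), `OS = ⋃_{s∈S} {o ↔ s}`, `BS = ⋃_{s∈S} {s ↔ b}`,
`Γ_x = {x ↮ b} ∩ (⋃_{s∈S} {x ↔ s}) ∩ BS` (gluing `S` into one vertex connects `x` to `b`: the exact gluing gain of `x`),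
`G_S = μ(BS) − τ(s₀)` (the gluing gain of the weakest member of `S`), `ROOM_S = μ((o↔c ∪ OS)ᶜ ∩ c↔b ∩ BSᶜ)`.

**(K₀-set)**  `μ(CSᶜ ∩ o↔c)·(G_S − μ(Γ_c)) ≤ μ(CSᶜ)·(G_S − μ(Γ_o))`.

For `S = {a₁, a₂}` this is VERBATIM the registered kernel (K₀) of the official skeleton (`stub_k0_dp`, line `tieline`:
`CSᶜ = N`, `G_S = μ(a₁↔b ∪ a₂↔b) − τ_{a₂}`, `Γ_x = G_x`), which the line has reduced to the covariance transfer (T).  This file shows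
that (K₀-set) for all glued sets with `|S| ≥ 2` implies the WHOLE crux, so the ≥ 4-relay triple-tie stub
`stub_additiveGluingTripleTieFour_c8` can be replaced by the `|S| ≥ 3` instances of the same kernel family (no ties at all).
`hHalf` = `twoStep_thm1_half` for the relays `(c, s₀)` of the `S`-glued weighting, pulled back along `ω ↦ ω ∪ D_S`
(`{c↮s₀}* = CSᶜ`, `{o↔b}* = o↔b ∪ (OS∩BS)`, `{s₀↔b}* = BS`, `{o↔c ∪ o↔s₀}* = o↔c ∪ OS`):
`μ(CSᶜ ∩ o↔c)·(μ(CSᶜ ∩ c↔b) − μ(CSᶜ ∩ BS)) ≤ μ(CSᶜ)·(μ((o↔b ∪ OS∩BS) ∩ (o↔c ∪ OS)) − μ((o↔c ∪ OS) ∩ BS))`.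
* `cag_insert_of_setHalf` — CAG for `{c} ⊔ S` (`μ(oA ∩ o↮b ∩ Ab) ≤ μ(Ab) − θ`) from `hHalf`, the branch-2 inequality (II′-set)
  `μ(CSᶜ ∩ o↔c)·(μ(BS) − τ_c − μ(Γ_c)) ≤ μ(CSᶜ)·(μ(BS) − θ + ROOM_S − μ(Γ_o))` and CAG for `S` (used only where `μ(CSᶜ) = 0`):
  `twoStep_cag3_of_branch2` with the pair replaced by a set.
* `cag_insert_of_k0setHalf` — (K₀-set) + `θ ≤ τ_c`, `θ ≤ τ(s₀)` ⟹ (II′-set) ⟹ CAG for `{c} ⊔ S`.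
* `cag_of_half_k0set2` — induction on `|A|` (spectator = any relay ≠ the minimiser `a₀`, `S = A ∖ {c} ∋ a₀ = s₀`).
* `additiveGluing_of_half_k0set2` — **`hHalf` + (K₀-set)_{|S| ≥ 2} ⟹ `AdditiveGluing`** (via the landed `additiveGluing_of_cag`).
Numerics: 0 violations of (K₀-set) in 1.14 M exact instances (n ≤ 7, |S| ≤ 4) + climbs; memo HOME `LeadMath-g2.md`.
[cite: KozmaNitzan2024, Theorem 1 / (6) (pp. 7–8), Lemma 4 / (8)–(9) (pp. 9–10), Question 7 (p. 36), §5.3 (p. 34)]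
[cite: VandenbergHaggstromKahn2005, Thms. 1.3–1.4]
-/

namespace Summit.CriticalPhenomena.PercolationContinuityZ3.Theorems

open MeasureTheory Set Literature.Probability.LatticeModels Literature.Probability.Percolation

noncomputable section
open Classical

variable {n : ℕ}

/-- **CAG for the relay set `{c} ⊔ S` from (II′-set).**  `S` a finite set of relays, spectator `c`, observer `o`, target `b`, a real `θ`;
hypotheses: the pulled-back one-sided weighted Kozma–Nitzan Theorem 1 of the `S`-glued weighting (`hH`, file header), CAG for `S` alone at level `θ` (`hS`, used only when `μ(c ↮ S) = 0`) and (II′-set)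
`μ(CSᶜ ∩ o↔c)·(μ(BS) − τ_c − μ(Γ_c)) ≤ μ(CSᶜ)·(μ(BS) − θ + ROOM_S − μ(Γ_o))` (file header).  Conclusion:
`μ((o↔c ∪ OS) ∩ (o↔b)ᶜ ∩ (c↔b ∪ BS)) ≤ μ(c↔b ∪ BS) − θ`.
Proof: event algebra on `hH` and (II′-set) (`{o↔b}* = o↔b ⊔ Γ_o`, `μ(BS) − τ_c − μ(Γ_c) = μ(CSᶜ∩BS) − μ(CSᶜ∩c↔b)`,
`μ(oA ∩ BS) = μ(oA ∩ Ab) − μ(Ab) + μ(BS) + ROOM_S`).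
[cite: KozmaNitzan2024, Theorem 1 / (6) (pp. 7–8), Lemma 4 (p. 9), Question 7 (p. 36)] -/
theorem cag_insert_of_setHalf (w : Sym2 (Fin n) → unitInterval) (S : Finset (Fin n)) (o b c : Fin n) (θ : ℝ)
    (hH : (prodBernoulli w).real ((⋃ s ∈ S, (openConn c s : Set (BondConfig (Fin n))))ᶜ ∩ openConn o c) *
        ((prodBernoulli w).real ((⋃ s ∈ S, (openConn c s : Set (BondConfig (Fin n))))ᶜ ∩ openConn c b) -
          (prodBernoulli w).real ((⋃ s ∈ S, (openConn c s : Set (BondConfig (Fin n))))ᶜ ∩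
            (⋃ s ∈ S, (openConn s b : Set (BondConfig (Fin n)))))) ≤
      (prodBernoulli w).real ((⋃ s ∈ S, (openConn c s : Set (BondConfig (Fin n))))ᶜ) *
        ((prodBernoulli w).real
            ((openConn o b ∪ ((⋃ s ∈ S, (openConn o s : Set (BondConfig (Fin n)))) ∩
                (⋃ s ∈ S, (openConn s b : Set (BondConfig (Fin n)))))) ∩
              (openConn o c ∪ ⋃ s ∈ S, (openConn o s : Set (BondConfig (Fin n))))) -
          (prodBernoulli w).real ((openConn o c ∪ ⋃ s ∈ S, (openConn o s : Set (BondConfig (Fin n)))) ∩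
            (⋃ s ∈ S, (openConn s b : Set (BondConfig (Fin n)))))))
    (hS : (prodBernoulli w).real ((⋃ s ∈ S, (openConn o s : Set (BondConfig (Fin n)))) ∩ (openConn o b)ᶜ ∩
        (⋃ s ∈ S, (openConn s b : Set (BondConfig (Fin n))))) ≤
      (prodBernoulli w).real (⋃ s ∈ S, (openConn s b : Set (BondConfig (Fin n)))) - θ)
    (hB2 : (prodBernoulli w).real ((⋃ s ∈ S, (openConn c s : Set (BondConfig (Fin n))))ᶜ ∩ openConn o c) *
        ((prodBernoulli w).real (⋃ s ∈ S, (openConn s b : Set (BondConfig (Fin n)))) -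
          (prodBernoulli w).real (openConn c b) -
          (prodBernoulli w).real ((openConn c b)ᶜ ∩ (⋃ s ∈ S, (openConn c s : Set (BondConfig (Fin n)))) ∩
            (⋃ s ∈ S, (openConn s b : Set (BondConfig (Fin n)))))) ≤
      (prodBernoulli w).real ((⋃ s ∈ S, (openConn c s : Set (BondConfig (Fin n))))ᶜ) *
        ((prodBernoulli w).real (⋃ s ∈ S, (openConn s b : Set (BondConfig (Fin n)))) - θ +
          (prodBernoulli w).real ((openConn o c ∪ ⋃ s ∈ S, (openConn o s : Set (BondConfig (Fin n))))ᶜ ∩ openConn c b ∩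
            (⋃ s ∈ S, (openConn s b : Set (BondConfig (Fin n))))ᶜ) -
          (prodBernoulli w).real ((openConn o b)ᶜ ∩ (⋃ s ∈ S, (openConn o s : Set (BondConfig (Fin n)))) ∩
            (⋃ s ∈ S, (openConn s b : Set (BondConfig (Fin n))))))) :
    (prodBernoulli w).real ((openConn o c ∪ ⋃ s ∈ S, (openConn o s : Set (BondConfig (Fin n)))) ∩ (openConn o b)ᶜ ∩
        (openConn c b ∪ ⋃ s ∈ S, (openConn s b : Set (BondConfig (Fin n))))) ≤
      (prodBernoulli w).real (openConn c b ∪ ⋃ s ∈ S, (openConn s b : Set (BondConfig (Fin n)))) - θ := by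
  have hm : ∀ s : Set (BondConfig (Fin n)), MeasurableSet s := fun _ => MeasurableSet.of_discrete
  set μ := prodBernoulli w with hμ
  set CS : Set (BondConfig (Fin n)) := ⋃ s ∈ S, (openConn c s : Set (BondConfig (Fin n))) with hCS
  set OS : Set (BondConfig (Fin n)) := ⋃ s ∈ S, (openConn o s : Set (BondConfig (Fin n))) with hOS
  set BS : Set (BondConfig (Fin n)) := ⋃ s ∈ S, (openConn s b : Set (BondConfig (Fin n))) with hBS
  set Oc : Set (BondConfig (Fin n)) := openConn o c with hOc
  set Ob : Set (BondConfig (Fin n)) := openConn o b with hOb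
  set Bc : Set (BondConfig (Fin n)) := openConn c b with hBc
  have mOS : ∀ ω, ω ∈ OS ↔ ∃ s ∈ S, ω ∈ (openConn o s : Set (BondConfig (Fin n))) := fun ω => by
    simp only [hOS, Set.mem_iUnion, exists_prop]
  have mBS : ∀ ω, ω ∈ BS ↔ ∃ s ∈ S, ω ∈ (openConn s b : Set (BondConfig (Fin n))) := fun ω => by
    simp only [hBS, Set.mem_iUnion, exists_prop]
  have mCS : ∀ ω, ω ∈ CS ↔ ∃ s ∈ S, ω ∈ (openConn c s : Set (BondConfig (Fin n))) := fun ω => by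
    simp only [hCS, Set.mem_iUnion, exists_prop]
  -- (I1) `μ((Ob ∪ OS∩BS) ∩ (Oc ∪ OS)) = μ(Ob ∩ (Oc ∪ OS)) + μ(Obᶜ ∩ OS ∩ BS)`
  have hI1 := measureReal_inter_add_sdiff (μ := μ) (s := (Ob ∪ OS ∩ BS) ∩ (Oc ∪ OS)) (hm Ob) (h := measure_ne_top _ _)
  have e1a : (Ob ∪ OS ∩ BS) ∩ (Oc ∪ OS) ∩ Ob = Ob ∩ (Oc ∪ OS) := by
    ext ω; simp only [Set.mem_inter_iff, Set.mem_union]; tauto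
  have e1b : ((Ob ∪ OS ∩ BS) ∩ (Oc ∪ OS)) \ Ob = Obᶜ ∩ OS ∩ BS := by
    ext ω; simp only [Set.mem_sdiff, Set.mem_inter_iff, Set.mem_union, Set.mem_compl_iff]; tauto
  rw [e1a, e1b] at hI1
  -- (I2) `μ(BS) − μ(Bc) − μ(Bcᶜ ∩ CS ∩ BS) = μ(CSᶜ ∩ BS) − μ(CSᶜ ∩ Bc)`
  have hI2a := measureReal_inter_add_sdiff (μ := μ) (s := BS) (hm CS) (h := measure_ne_top _ _)
  have hI2b := measureReal_inter_add_sdiff (μ := μ) (s := Bc) (hm CS) (h := measure_ne_top _ _)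
  have hI2c := measureReal_inter_add_sdiff (μ := μ) (s := BS ∩ CS) (hm Bc) (h := measure_ne_top _ _)
  have e2a : BS \ CS = CSᶜ ∩ BS := by ext ω; simp only [Set.mem_sdiff, Set.mem_inter_iff, Set.mem_compl_iff]; tauto
  have e2b : Bc \ CS = CSᶜ ∩ Bc := by ext ω; simp only [Set.mem_sdiff, Set.mem_inter_iff, Set.mem_compl_iff]; tauto
  have e2c : BS ∩ CS ∩ Bc = Bc ∩ CS := by
    ext ω
    simp only [Set.mem_inter_iff, mBS, mCS]
    constructor
    · rintro ⟨⟨_, h2⟩, h3⟩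
      exact ⟨h3, h2⟩
    · rintro ⟨h3, ⟨s, hs, h⟩⟩
      exact ⟨⟨⟨s, hs, SimpleGraph.Reachable.trans (SimpleGraph.Reachable.symm h) h3⟩, ⟨s, hs, h⟩⟩, h3⟩
  have e2d : (BS ∩ CS) \ Bc = Bcᶜ ∩ CS ∩ BS := by
    ext ω; simp only [Set.mem_sdiff, Set.mem_inter_iff, Set.mem_compl_iff]; tauto
  rw [e2a] at hI2a
  rw [e2b] at hI2b
  rw [e2c, e2d] at hI2c
  -- (I3) `μ(O ∩ Obᶜ ∩ AB) = μ(O ∩ AB) − μ(Ob ∩ O)`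
  have hI3 := measureReal_inter_add_sdiff (μ := μ) (s := (Oc ∪ OS) ∩ (Bc ∪ BS)) (hm Ob) (h := measure_ne_top _ _)
  have e3a : (Oc ∪ OS) ∩ (Bc ∪ BS) ∩ Ob = Ob ∩ (Oc ∪ OS) := by
    ext ω
    simp only [Set.mem_inter_iff, Set.mem_union, mOS, mBS]
    constructor
    · rintro ⟨⟨hO, _⟩, hb⟩
      exact ⟨hb, hO⟩
    · rintro ⟨hb, hO⟩
      refine ⟨⟨hO, ?_⟩, hb⟩
      rcases hO with h | ⟨s, hs, h⟩
      · exact Or.inl (SimpleGraph.Reachable.trans (SimpleGraph.Reachable.symm h) hb)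
      · exact Or.inr ⟨s, hs, SimpleGraph.Reachable.trans (SimpleGraph.Reachable.symm h) hb⟩
  have e3b : ((Oc ∪ OS) ∩ (Bc ∪ BS)) \ Ob = (Oc ∪ OS) ∩ Obᶜ ∩ (Bc ∪ BS) := by
    ext ω; simp only [Set.mem_sdiff, Set.mem_inter_iff, Set.mem_compl_iff]; tauto
  rw [e3a, e3b] at hI3
  -- (I4) `μ(O ∩ BS) = μ(O ∩ AB) − μ(AB) + μ(BS) + ROOM_S`
  have hI4a := measureReal_inter_add_sdiff (μ := μ) (s := (Oc ∪ OS) ∩ (Bc ∪ BS)) (hm BS) (h := measure_ne_top _ _)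
  have e4a : (Oc ∪ OS) ∩ (Bc ∪ BS) ∩ BS = (Oc ∪ OS) ∩ BS := by
    ext ω; simp only [Set.mem_inter_iff, Set.mem_union]; tauto
  have e4b : ((Oc ∪ OS) ∩ (Bc ∪ BS)) \ BS = (Oc ∪ OS) ∩ Bc ∩ BSᶜ := by
    ext ω; simp only [Set.mem_sdiff, Set.mem_inter_iff, Set.mem_union, Set.mem_compl_iff]; tauto
  rw [e4a, e4b] at hI4a
  have hI4b := measureReal_inter_add_sdiff (μ := μ) (s := Bc ∪ BS) (hm BS) (h := measure_ne_top _ _)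
  have e4c : (Bc ∪ BS) ∩ BS = BS := by ext ω; simp only [Set.mem_inter_iff, Set.mem_union]; tauto
  have e4d : (Bc ∪ BS) \ BS = Bc ∩ BSᶜ := by
    ext ω; simp only [Set.mem_sdiff, Set.mem_inter_iff, Set.mem_union, Set.mem_compl_iff]; tauto
  rw [e4c, e4d] at hI4b
  have hI4c := measureReal_inter_add_sdiff (μ := μ) (s := Bc ∩ BSᶜ) (hm (Oc ∪ OS)) (h := measure_ne_top _ _)
  have e4e : Bc ∩ BSᶜ ∩ (Oc ∪ OS) = (Oc ∪ OS) ∩ Bc ∩ BSᶜ := by ext ω; simp only [Set.mem_inter_iff]; tauto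
  have e4f : (Bc ∩ BSᶜ) \ (Oc ∪ OS) = (Oc ∪ OS)ᶜ ∩ Bc ∩ BSᶜ := by
    ext ω; simp only [Set.mem_sdiff, Set.mem_inter_iff, Set.mem_compl_iff]; tauto
  rw [e4e, e4f] at hI4c
  have hD0 : 0 ≤ μ.real CSᶜ := measureReal_nonneg
  have key : 0 ≤ μ.real CSᶜ * (μ.real (Bc ∪ BS) - θ - μ.real ((Oc ∪ OS) ∩ Obᶜ ∩ (Bc ∪ BS))) := by
    have h1 : μ.real CSᶜ * (μ.real (Bc ∪ BS) - θ - μ.real ((Oc ∪ OS) ∩ Obᶜ ∩ (Bc ∪ BS))) =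
        μ.real CSᶜ * ((μ.real (Ob ∩ (Oc ∪ OS)) + μ.real (Obᶜ ∩ OS ∩ BS)) - μ.real ((Oc ∪ OS) ∩ BS)) +
          μ.real CSᶜ * (μ.real BS - θ + μ.real ((Oc ∪ OS)ᶜ ∩ Bc ∩ BSᶜ) - μ.real (Obᶜ ∩ OS ∩ BS)) := by
      ring_nf
      nlinarith [hI3, hI4a, hI4b, hI4c]
    have h2' : μ.real (CSᶜ ∩ Bc) - μ.real (CSᶜ ∩ BS) = -(μ.real BS - μ.real Bc - μ.real (Bcᶜ ∩ CS ∩ BS)) := by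
      linarith [hI2a, hI2b, hI2c]
    have h2 : μ.real (CSᶜ ∩ Oc) * (μ.real (CSᶜ ∩ Bc) - μ.real (CSᶜ ∩ BS)) =
        -(μ.real (CSᶜ ∩ Oc) * (μ.real BS - μ.real Bc - μ.real (Bcᶜ ∩ CS ∩ BS))) := by
      rw [h2']; ring
    rw [h1]
    rw [← hI1] at hH
    nlinarith [hH, hB2, h2]
  rcases hD0.eq_or_lt with h0 | hpos
  · -- degenerate locus `μ(c ↮ S) = 0`: reduce to CAG for `S`
    have h5 := measureReal_inter_add_sdiff (μ := μ) (s := (Oc ∪ OS) ∩ Obᶜ ∩ (Bc ∪ BS)) (hm CS) (h := measure_ne_top _ _)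
    have h6 : μ.real (((Oc ∪ OS) ∩ Obᶜ ∩ (Bc ∪ BS)) \ CS) ≤ μ.real CSᶜ :=
      measureReal_mono (fun ω hω => hω.2) (measure_ne_top _ _)
    have h7 : μ.real ((Oc ∪ OS) ∩ Obᶜ ∩ (Bc ∪ BS) ∩ CS) ≤ μ.real (OS ∩ Obᶜ ∩ BS) := by
      refine measureReal_mono (fun ω hω => ?_) (measure_ne_top _ _)
      simp only [Set.mem_inter_iff, Set.mem_union, Set.mem_compl_iff, mOS, mBS, mCS] at hω ⊢
      obtain ⟨⟨⟨hO, hOb⟩, hB⟩, ⟨s, hs, hcs⟩⟩ := hω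
      refine ⟨⟨?_, hOb⟩, ?_⟩
      · rcases hO with h | h
        · exact ⟨s, hs, SimpleGraph.Reachable.trans h hcs⟩
        · exact h
      · rcases hB with h | h
        · exact ⟨s, hs, SimpleGraph.Reachable.trans (SimpleGraph.Reachable.symm hcs) h⟩
        · exact h
    have h8 : μ.real BS ≤ μ.real (Bc ∪ BS) := measureReal_mono Set.subset_union_right (measure_ne_top _ _)
    linarith
  · have := (mul_nonneg_iff_of_pos_left hpos).1 key
    linarith

/-- **CAG for `{c} ⊔ S` from (K₀-set).**  With `s₀ ∈ S` a minimiser of `τ` on `S`, `c ∉ S`, `θ ≤ τ_c`, `θ ≤ τ(s₀)`, CAG for `S`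
at level `θ` (`hS`) and the (K₀-set) instance `μ(CSᶜ ∩ o↔c)·(G_S − μ(Γ_c)) ≤ μ(CSᶜ)·(G_S − μ(Γ_o))`, `G_S = μ(BS) − τ(s₀)`:
`μ((o↔c ∪ OS) ∩ (o↔b)ᶜ ∩ (c↔b ∪ BS)) ≤ μ(c↔b ∪ BS) − θ`.  ((K₀-set) and the two `θ`-bounds give (II′-set); then
`cag_insert_of_setHalf`.) [cite: KozmaNitzan2024, Lemma 4 (p. 9), Question 7 (p. 36)] -/
theorem cag_insert_of_k0setHalf (w : Sym2 (Fin n) → unitInterval) (S : Finset (Fin n)) (o b c s₀ : Fin n) (θ : ℝ)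
    (hH : (prodBernoulli w).real ((⋃ s ∈ S, (openConn c s : Set (BondConfig (Fin n))))ᶜ ∩ openConn o c) *
        ((prodBernoulli w).real ((⋃ s ∈ S, (openConn c s : Set (BondConfig (Fin n))))ᶜ ∩ openConn c b) -
          (prodBernoulli w).real ((⋃ s ∈ S, (openConn c s : Set (BondConfig (Fin n))))ᶜ ∩
            (⋃ s ∈ S, (openConn s b : Set (BondConfig (Fin n)))))) ≤
      (prodBernoulli w).real ((⋃ s ∈ S, (openConn c s : Set (BondConfig (Fin n))))ᶜ) *
        ((prodBernoulli w).real
            ((openConn o b ∪ ((⋃ s ∈ S, (openConn o s : Set (BondConfig (Fin n)))) ∩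
                (⋃ s ∈ S, (openConn s b : Set (BondConfig (Fin n)))))) ∩
              (openConn o c ∪ ⋃ s ∈ S, (openConn o s : Set (BondConfig (Fin n))))) -
          (prodBernoulli w).real ((openConn o c ∪ ⋃ s ∈ S, (openConn o s : Set (BondConfig (Fin n)))) ∩
            (⋃ s ∈ S, (openConn s b : Set (BondConfig (Fin n)))))))
    (hθc : θ ≤ (prodBernoulli w).real (openConn c b)) (hθs : θ ≤ (prodBernoulli w).real (openConn s₀ b))
    (hS : (prodBernoulli w).real ((⋃ s ∈ S, (openConn o s : Set (BondConfig (Fin n)))) ∩ (openConn o b)ᶜ ∩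
        (⋃ s ∈ S, (openConn s b : Set (BondConfig (Fin n))))) ≤
      (prodBernoulli w).real (⋃ s ∈ S, (openConn s b : Set (BondConfig (Fin n)))) - θ)
    (hK : (prodBernoulli w).real ((⋃ s ∈ S, (openConn c s : Set (BondConfig (Fin n))))ᶜ ∩ openConn o c) *
        ((prodBernoulli w).real (⋃ s ∈ S, (openConn s b : Set (BondConfig (Fin n)))) -
          (prodBernoulli w).real (openConn s₀ b) -
          (prodBernoulli w).real ((openConn c b)ᶜ ∩ (⋃ s ∈ S, (openConn c s : Set (BondConfig (Fin n)))) ∩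
            (⋃ s ∈ S, (openConn s b : Set (BondConfig (Fin n)))))) ≤
      (prodBernoulli w).real ((⋃ s ∈ S, (openConn c s : Set (BondConfig (Fin n))))ᶜ) *
        ((prodBernoulli w).real (⋃ s ∈ S, (openConn s b : Set (BondConfig (Fin n)))) -
          (prodBernoulli w).real (openConn s₀ b) -
          (prodBernoulli w).real ((openConn o b)ᶜ ∩ (⋃ s ∈ S, (openConn o s : Set (BondConfig (Fin n)))) ∩
            (⋃ s ∈ S, (openConn s b : Set (BondConfig (Fin n))))))) :
    (prodBernoulli w).real ((openConn o c ∪ ⋃ s ∈ S, (openConn o s : Set (BondConfig (Fin n)))) ∩ (openConn o b)ᶜ ∩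
        (openConn c b ∪ ⋃ s ∈ S, (openConn s b : Set (BondConfig (Fin n))))) ≤
      (prodBernoulli w).real (openConn c b ∪ ⋃ s ∈ S, (openConn s b : Set (BondConfig (Fin n)))) - θ := by
  refine cag_insert_of_setHalf w S o b c θ hH hS ?_
  have hψ : (prodBernoulli w).real ((⋃ s ∈ S, (openConn c s : Set (BondConfig (Fin n))))ᶜ ∩ openConn o c) ≤
      (prodBernoulli w).real ((⋃ s ∈ S, (openConn c s : Set (BondConfig (Fin n))))ᶜ) :=
    measureReal_mono Set.inter_subset_left (measure_ne_top _ _)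
  have hψ0 : 0 ≤ (prodBernoulli w).real ((⋃ s ∈ S, (openConn c s : Set (BondConfig (Fin n))))ᶜ ∩ openConn o c) :=
    measureReal_nonneg
  have hR : 0 ≤ (prodBernoulli w).real ((openConn o c ∪ ⋃ s ∈ S, (openConn o s : Set (BondConfig (Fin n))))ᶜ ∩
      openConn c b ∩ (⋃ s ∈ S, (openConn s b : Set (BondConfig (Fin n))))ᶜ) := measureReal_nonneg
  have hD0 : 0 ≤ (prodBernoulli w).real ((⋃ s ∈ S, (openConn c s : Set (BondConfig (Fin n))))ᶜ) := measureReal_nonneg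
  have h1 := mul_le_mul_of_nonneg_right hψ (sub_nonneg.2 hθs)
  have h2 : (prodBernoulli w).real ((⋃ s ∈ S, (openConn c s : Set (BondConfig (Fin n))))ᶜ ∩ openConn o c) *
      ((prodBernoulli w).real (⋃ s ∈ S, (openConn s b : Set (BondConfig (Fin n)))) -
          (prodBernoulli w).real (openConn c b) -
          (prodBernoulli w).real ((openConn c b)ᶜ ∩ (⋃ s ∈ S, (openConn c s : Set (BondConfig (Fin n)))) ∩
            (⋃ s ∈ S, (openConn s b : Set (BondConfig (Fin n)))))) ≤
      (prodBernoulli w).real ((⋃ s ∈ S, (openConn c s : Set (BondConfig (Fin n))))ᶜ ∩ openConn o c) *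
      ((prodBernoulli w).real (⋃ s ∈ S, (openConn s b : Set (BondConfig (Fin n)))) - θ -
          (prodBernoulli w).real ((openConn c b)ᶜ ∩ (⋃ s ∈ S, (openConn c s : Set (BondConfig (Fin n)))) ∩
            (⋃ s ∈ S, (openConn s b : Set (BondConfig (Fin n)))))) :=
    mul_le_mul_of_nonneg_left (by linarith) hψ0
  have h3 := mul_nonneg hD0 hR
  nlinarith [hK, h1, h2, h3]

/-- **CAG for every relay set from (K₀-set) for `|S| ≥ 2`**, by induction on `|A|`: for `|A| = 1` the event is empty; for `|A| ≥ 2`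
take any `c ∈ A` other than the minimiser `a₀` and glue `S = A ∖ {c} ∋ a₀` (`cag_insert_of_k0setHalf` with `s₀ = a₀`; when `S = {a₀}`
the kernel instance is `0 ≤ 0` because nothing is gained by gluing a singleton; the induction hypothesis serves the degenerate locus
`μ(c ↮ S) = 0`). [cite: KozmaNitzan2024, Lemma 4 (p. 9), Question 7 (p. 36), §5.3 (p. 34)] -/
theorem cag_of_half_k0set2
    (hHalf : ∀ (n : ℕ) (w : Sym2 (Fin n) → unitInterval) (S : Finset (Fin n)) (o b c : Fin n), S.Nonempty → c ∉ S →
      (prodBernoulli w).real ((⋃ s ∈ S, (openConn c s : Set (BondConfig (Fin n))))ᶜ ∩ openConn o c) *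
          ((prodBernoulli w).real ((⋃ s ∈ S, (openConn c s : Set (BondConfig (Fin n))))ᶜ ∩ openConn c b) -
            (prodBernoulli w).real ((⋃ s ∈ S, (openConn c s : Set (BondConfig (Fin n))))ᶜ ∩
              (⋃ s ∈ S, (openConn s b : Set (BondConfig (Fin n)))))) ≤
        (prodBernoulli w).real ((⋃ s ∈ S, (openConn c s : Set (BondConfig (Fin n))))ᶜ) *
          ((prodBernoulli w).real
              ((openConn o b ∪ ((⋃ s ∈ S, (openConn o s : Set (BondConfig (Fin n)))) ∩
                  (⋃ s ∈ S, (openConn s b : Set (BondConfig (Fin n)))))) ∩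
                (openConn o c ∪ ⋃ s ∈ S, (openConn o s : Set (BondConfig (Fin n))))) -
            (prodBernoulli w).real ((openConn o c ∪ ⋃ s ∈ S, (openConn o s : Set (BondConfig (Fin n)))) ∩
              (⋃ s ∈ S, (openConn s b : Set (BondConfig (Fin n)))))))
    (hK : ∀ (n : ℕ) (w : Sym2 (Fin n) → unitInterval) (S : Finset (Fin n)) (o b c s₀ : Fin n), 2 ≤ S.card → s₀ ∈ S → c ∉ S →
      (∀ s ∈ S, (prodBernoulli w).real (openConn s₀ b) ≤ (prodBernoulli w).real (openConn s b)) →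
      (prodBernoulli w).real ((⋃ s ∈ S, (openConn c s : Set (BondConfig (Fin n))))ᶜ ∩ openConn o c) *
          ((prodBernoulli w).real (⋃ s ∈ S, (openConn s b : Set (BondConfig (Fin n)))) -
            (prodBernoulli w).real (openConn s₀ b) -
            (prodBernoulli w).real ((openConn c b)ᶜ ∩ (⋃ s ∈ S, (openConn c s : Set (BondConfig (Fin n)))) ∩
              (⋃ s ∈ S, (openConn s b : Set (BondConfig (Fin n)))))) ≤
        (prodBernoulli w).real ((⋃ s ∈ S, (openConn c s : Set (BondConfig (Fin n))))ᶜ) *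
          ((prodBernoulli w).real (⋃ s ∈ S, (openConn s b : Set (BondConfig (Fin n)))) -
            (prodBernoulli w).real (openConn s₀ b) -
            (prodBernoulli w).real ((openConn o b)ᶜ ∩ (⋃ s ∈ S, (openConn o s : Set (BondConfig (Fin n)))) ∩
              (⋃ s ∈ S, (openConn s b : Set (BondConfig (Fin n))))))) :
    ∀ (m : ℕ) (n : ℕ) (w : Sym2 (Fin n) → unitInterval) (A : Finset (Fin n)) (o b a₀ : Fin n), A.card = m → a₀ ∈ A →
      (∀ a ∈ A, (prodBernoulli w).real (openConn a₀ b) ≤ (prodBernoulli w).real (openConn a b)) →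
      (prodBernoulli w).real ((⋃ a ∈ A, (openConn o a : Set (BondConfig (Fin n)))) ∩ (openConn o b)ᶜ ∩
          (⋃ a ∈ A, (openConn a b : Set (BondConfig (Fin n))))) ≤
        (prodBernoulli w).real (⋃ a ∈ A, (openConn a b : Set (BondConfig (Fin n)))) - (prodBernoulli w).real (openConn a₀ b) := by
  intro m
  induction m with
  | zero =>
    intro n w A o b a₀ hcard ha₀ _
    rw [Finset.card_eq_zero] at hcard
    rw [hcard] at ha₀
    exact absurd ha₀ (Finset.notMem_empty a₀)
  | succ m ih =>
    intro n w A o b a₀ hcard ha₀ hmin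
    by_cases hT : A.erase a₀ = ∅
    · have hA : A = {a₀} := by
        rw [← Finset.insert_erase ha₀, hT]
        rfl
      subst hA
      have hsub : ((⋃ a ∈ ({a₀} : Finset (Fin n)), (openConn o a : Set (BondConfig (Fin n)))) ∩ (openConn o b)ᶜ ∩
          (⋃ a ∈ ({a₀} : Finset (Fin n)), (openConn a b : Set (BondConfig (Fin n))))) ⊆ (∅ : Set (BondConfig (Fin n))) := by
        intro ω hω
        simp only [Set.mem_inter_iff, Set.mem_compl_iff, Set.mem_iUnion, exists_prop, Finset.mem_singleton] at hω
        obtain ⟨⟨⟨a, ha, h1⟩, h2⟩, ⟨a', ha', h3⟩⟩ := hω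
        rw [ha] at h1
        rw [ha'] at h3
        exact h2 (SimpleGraph.Reachable.trans h1 h3)
      have h0 := measureReal_mono (μ := prodBernoulli w) hsub (measure_ne_top _ _)
      rw [measureReal_empty] at h0
      have : (prodBernoulli w).real (openConn a₀ b) ≤
          (prodBernoulli w).real (⋃ a ∈ ({a₀} : Finset (Fin n)), (openConn a b : Set (BondConfig (Fin n)))) := by
        refine measureReal_mono (fun ω hω => ?_) (measure_ne_top _ _)
        simp only [Set.mem_iUnion, exists_prop, Finset.mem_singleton]
        exact ⟨a₀, rfl, hω⟩
      linarith
    · obtain ⟨c, hc⟩ := Finset.nonempty_of_ne_empty hT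
      have hcA : c ∈ A := Finset.mem_of_mem_erase hc
      have hca : c ≠ a₀ := Finset.ne_of_mem_erase hc
      set S := A.erase c with hSdef
      have ha₀S : a₀ ∈ S := Finset.mem_erase.2 ⟨hca.symm, ha₀⟩
      have hcS : c ∉ S := Finset.notMem_erase c A
      have hScard : S.card = m := by
        rw [hSdef, Finset.card_erase_of_mem hcA, hcard]
        rfl
      have hminS : ∀ s ∈ S, (prodBernoulli w).real (openConn a₀ b) ≤ (prodBernoulli w).real (openConn s b) :=
        fun s hs => hmin s (Finset.mem_of_mem_erase hs)
      have hIH := ih n w S o b a₀ hScard ha₀S hminS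
      have hKi : (prodBernoulli w).real ((⋃ s ∈ S, (openConn c s : Set (BondConfig (Fin n))))ᶜ ∩ openConn o c) *
          ((prodBernoulli w).real (⋃ s ∈ S, (openConn s b : Set (BondConfig (Fin n)))) -
            (prodBernoulli w).real (openConn a₀ b) -
            (prodBernoulli w).real ((openConn c b)ᶜ ∩ (⋃ s ∈ S, (openConn c s : Set (BondConfig (Fin n)))) ∩
              (⋃ s ∈ S, (openConn s b : Set (BondConfig (Fin n)))))) ≤
        (prodBernoulli w).real ((⋃ s ∈ S, (openConn c s : Set (BondConfig (Fin n))))ᶜ) *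
          ((prodBernoulli w).real (⋃ s ∈ S, (openConn s b : Set (BondConfig (Fin n)))) -
            (prodBernoulli w).real (openConn a₀ b) -
            (prodBernoulli w).real ((openConn o b)ᶜ ∩ (⋃ s ∈ S, (openConn o s : Set (BondConfig (Fin n)))) ∩
              (⋃ s ∈ S, (openConn s b : Set (BondConfig (Fin n)))))) := by
        rcases Nat.lt_or_ge S.card 2 with hlt | h2
        · -- `S = {a₀}`: both gluing gains vanish and `G_S = 0`
          have hS1 : S.card = 1 := by
            have hSpos : 0 < S.card := Finset.card_pos.2 ⟨a₀, ha₀S⟩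
            omega
          obtain ⟨a, ha⟩ := Finset.card_eq_one.1 hS1
          have haa : a₀ = a := by
            have : a₀ ∈ ({a} : Finset (Fin n)) := ha ▸ ha₀S
            exact Finset.mem_singleton.1 this
          rw [ha, ← haa]
          simp only [Finset.set_biUnion_singleton]
          have hΓ : ∀ x : Fin n, (prodBernoulli w).real ((openConn x b)ᶜ ∩ openConn x a₀ ∩ openConn a₀ b :
              Set (BondConfig (Fin n))) = 0 := by
            intro x
            have hsub : ((openConn x b)ᶜ ∩ openConn x a₀ ∩ openConn a₀ b : Set (BondConfig (Fin n))) ⊆ ∅ := by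
              rintro ω ⟨⟨h1, h2⟩, h3⟩
              exact h1 (SimpleGraph.Reachable.trans h2 h3)
            have h0 := measureReal_mono (μ := prodBernoulli w) hsub (measure_ne_top _ _)
            rw [measureReal_empty] at h0
            exact le_antisymm h0 measureReal_nonneg
          rw [hΓ c, hΓ o]
          simp
        · exact hK n w S o b c a₀ h2 ha₀S hcS hminS
      have hres := cag_insert_of_k0setHalf w S o b c a₀ ((prodBernoulli w).real (openConn a₀ b))
        (hHalf n w S o b c ⟨a₀, ha₀S⟩ hcS) (hmin c hcA) le_rfl hIH hKi
      have hAe : A = insert c S := by rw [hSdef, Finset.insert_erase hcA]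
      rw [hAe, Finset.set_biUnion_insert, Finset.set_biUnion_insert]
      exact hres

/-- **(K₀-set) for `|S| ≥ 2` ⟹ `AdditiveGluing`, given the pulled-back half Theorem 1 `hHalf`** (file header; `hHalf` is
`twoStep_thm1_half` in the `S`-glued weighting pulled back by `setGlue_pull_*` of `…SetGluePullback.lean`, discharged in the sibling
file `…SetGlueK0Closed.lean`).  Via `cag_of_half_k0set2` and the landed `additiveGluing_of_cag`.
[cite: KozmaNitzan2024, Conjecture 1 (p. 3), Theorem 1 (pp. 7–8), Lemma 4 (p. 9), Question 7 (p. 36), §5.3 (p. 34)] -/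
theorem additiveGluing_of_half_k0set2
    (hHalf : ∀ (n : ℕ) (w : Sym2 (Fin n) → unitInterval) (S : Finset (Fin n)) (o b c : Fin n), S.Nonempty → c ∉ S →
      (prodBernoulli w).real ((⋃ s ∈ S, (openConn c s : Set (BondConfig (Fin n))))ᶜ ∩ openConn o c) *
          ((prodBernoulli w).real ((⋃ s ∈ S, (openConn c s : Set (BondConfig (Fin n))))ᶜ ∩ openConn c b) -
            (prodBernoulli w).real ((⋃ s ∈ S, (openConn c s : Set (BondConfig (Fin n))))ᶜ ∩
              (⋃ s ∈ S, (openConn s b : Set (BondConfig (Fin n)))))) ≤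
        (prodBernoulli w).real ((⋃ s ∈ S, (openConn c s : Set (BondConfig (Fin n))))ᶜ) *
          ((prodBernoulli w).real
              ((openConn o b ∪ ((⋃ s ∈ S, (openConn o s : Set (BondConfig (Fin n)))) ∩
                  (⋃ s ∈ S, (openConn s b : Set (BondConfig (Fin n)))))) ∩
                (openConn o c ∪ ⋃ s ∈ S, (openConn o s : Set (BondConfig (Fin n))))) -
            (prodBernoulli w).real ((openConn o c ∪ ⋃ s ∈ S, (openConn o s : Set (BondConfig (Fin n)))) ∩
              (⋃ s ∈ S, (openConn s b : Set (BondConfig (Fin n)))))))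
    (hK : ∀ (n : ℕ) (w : Sym2 (Fin n) → unitInterval) (S : Finset (Fin n)) (o b c s₀ : Fin n), 2 ≤ S.card → s₀ ∈ S → c ∉ S →
      (∀ s ∈ S, (prodBernoulli w).real (openConn s₀ b) ≤ (prodBernoulli w).real (openConn s b)) →
      (prodBernoulli w).real ((⋃ s ∈ S, (openConn c s : Set (BondConfig (Fin n))))ᶜ ∩ openConn o c) *
          ((prodBernoulli w).real (⋃ s ∈ S, (openConn s b : Set (BondConfig (Fin n)))) -
            (prodBernoulli w).real (openConn s₀ b) -
            (prodBernoulli w).real ((openConn c b)ᶜ ∩ (⋃ s ∈ S, (openConn c s : Set (BondConfig (Fin n)))) ∩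
              (⋃ s ∈ S, (openConn s b : Set (BondConfig (Fin n)))))) ≤
        (prodBernoulli w).real ((⋃ s ∈ S, (openConn c s : Set (BondConfig (Fin n))))ᶜ) *
          ((prodBernoulli w).real (⋃ s ∈ S, (openConn s b : Set (BondConfig (Fin n)))) -
            (prodBernoulli w).real (openConn s₀ b) -
            (prodBernoulli w).real ((openConn o b)ᶜ ∩ (⋃ s ∈ S, (openConn o s : Set (BondConfig (Fin n)))) ∩
              (⋃ s ∈ S, (openConn s b : Set (BondConfig (Fin n))))))) :
    Summit.CriticalPhenomena.PercolationContinuityZ3.Theses.PercNearOneGluing.AdditiveGluing :=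
  additiveGluing_of_cag fun n w A o b a₀ ha₀ hmin => cag_of_half_k0set2 hHalf hK A.card n w A o b a₀ rfl ha₀ hmin

end

end Summit.CriticalPhenomena.PercolationContinuityZ3.Theorems
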